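import Summits.CriticalPhenomena.PercolationContinuityZ3.Theorems.PercNearOneGluingNoHeavyLowerTailSahiFreeSlotFourData
import Summits.CriticalPhenomena.PercolationContinuityZ3.Theorems.PercNearOneGluingNoHeavyLowerTailSahiFreeSlotPeel
import HarnessLib

/-!
# `NoHeavyLowerTail` (stmt-CriticalPhenomena-4575) — TOP-REGION PEELING at order 4, kernel form: the pattern inequalities
# `Δ_W ≥ 0` for gen 17's 7-variable densities `zWK`, and the cell-level peeling inequality

Support file, seat `prim-l12-p5` (gen 18), `--supports stmt-CriticalPhenomena-4575`.  COMPUTATIONAL (`native_decide` runs of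
`SahiHitting.boxcheckK`, ≤ a few hundred recursion nodes each), otherwise standard axioms; no sorries, no named facts.
Memo FROM-prim-l12-p5-g18-TOP-PEELING §1, proof note PEELING-PROOF-g18.md §3–5.  In gen 17's vocabulary (`…SahiFreeSlotFourData`: 7 Venn
regions of three slots, `x 6` = closed-probability of the TOP region `{0,1,2}`, `zWK W` = the free-slot density `z_W` as an integer polynomial):
* `setOneK` (delete the top region: `x 6 := 1`) and `peelDeltaK W` = `Δ_W := z'_O·(x₆ z_W + (1−x₆) z_O) − z_O·z'_W` as list polynomials;
* `peel_cert` — `boxcheckK` accepts `Δ_W` for the 7 deficient patterns and `z_O` (tensor-Bernstein sign certificate with domination leaves);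
* **`peelDelta_nonneg`**, **`zO_four_nonneg`** — `Δ_W ≥ 0`, `z_O ≥ 0` on `[0,1]^7`;
* **`peel_sum_ineq_four`** — for every `x ∈ [0,1]^7` and every family `U` of nodes closed under adding the top region:
  `z_O(x') · Σ_{R∈U} z_{patt R}(x)·cellProb x R  ≥  z_O(x) · Σ_{R∈U} z_{patt R}(x')·cellProb x' R`, `x' = x[6 ↦ 1]`
  (the right-hand sum is the free-slot sum of the configuration WITHOUT the top region: `cellProb x' R = 0` when `6 ∈ R`).
  With gen 17's `sum_upper_nonneg_of_checkAll` this is the order-4 instance of "F(n+1,1)∀X ⟺ its top-free case". [this work]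
-/

namespace Summit.CriticalPhenomena.PercolationContinuityZ3.Theorems

namespace SahiFreeSlot

open Finset SahiHitting

/-! ## Substituting `x_i := 1` in a list polynomial -/

/-- Set the variable `i` to `1`: zero its exponent in every term. [this work] -/
def setOneK (i : Fin 7) (L : List (ℤ × List ℕ)) : List (ℤ × List ℕ) := L.map fun t => (t.1, t.2.set i.1 0)

/-- A monomial with exponent `i` zeroed is the monomial at `x[i ↦ 1]`. [folklore] -/
theorem monoK_set_zero_eq (e : List ℕ) (i : Fin 7) (x : Fin 7 → ℝ) :
    monoK 7 (e.set i.1 0) x = monoK 7 e (Function.update x i 1) := by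
  unfold monoK
  refine Finset.prod_congr rfl fun j _ => ?_
  rw [getD_set_zero]
  by_cases h : j = i
  · subst h; simp
  · have h1 : (i : ℕ) ≠ (j : ℕ) := fun hh => h (Fin.ext hh).symm
    rw [if_neg h1, Function.update_of_ne h]

/-- Value of `setOneK i L`: the value of `L` at `x[i ↦ 1]`. [this work] -/
theorem evalKL_setOneK (i : Fin 7) : ∀ (L : List (ℤ × List ℕ)) (x : Fin 7 → ℝ),
    evalKL 7 (setOneK i L) x = evalKL 7 L (Function.update x i 1)
  | [], x => by simp [setOneK, evalKL]
  | t :: L, x => by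
    have ih := evalKL_setOneK i L x
    rw [setOneK, List.map_cons, evalKL_cons_monoK, evalKL_cons_monoK, ← ih, monoK_set_zero_eq]
    rfl

/-! ## `Δ_W` and `z_O` as list polynomials; the certificates -/

/-- `Δ_W := z'_O·(x₆·z_W + (1−x₆)·z_O) − z_O·z'_W` (primes: top region deleted, `x₆ := 1`). [this work] -/
def peelDeltaK (W : Finset (Fin 3)) : List (ℤ × List ℕ) :=
  normK (sumK [pmulK (setOneK 6 (zWK Finset.univ)) (pmulK (XK 6) (zWK W)),
    pmulK (setOneK 6 (zWK Finset.univ)) (pmulK (oneSubXK 6) (zWK Finset.univ)),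
    pnegK (pmulK (zWK Finset.univ) (setOneK 6 (zWK W)))])

/-- Value of `peelDeltaK W`. [this work] -/
theorem evalKL_peelDeltaK (W : Finset (Fin 3)) (x : Fin 7 → ℝ) :
    evalKL 7 (peelDeltaK W) x =
      evalKL 7 (zWK Finset.univ) (Function.update x 6 1) *
          (x 6 * evalKL 7 (zWK W) x + (1 - x 6) * evalKL 7 (zWK Finset.univ) x)
        - evalKL 7 (zWK Finset.univ) x * evalKL 7 (zWK W) (Function.update x 6 1) := by
  rw [peelDeltaK, evalKL_normK, evalKL_sumK]
  simp only [List.map_cons, List.map_nil, List.sum_cons, List.sum_nil, evalKL_pmulK, evalKL_pnegK, evalKL_XK,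
    evalKL_oneSubXK, evalKL_setOneK (6 : Fin 7)]
  ring

/-- Degree bounds for the peeling polynomials (variable, degree). [this work] -/
def vsPeel : List (ℕ × ℕ) := [(0, 2), (1, 2), (2, 2), (3, 4), (4, 4), (5, 4), (6, 4)]

/-- Degree guard against `vsPeel`. [this work] -/
def degOKPeel (L : List (ℤ × List ℕ)) : Bool := L.all fun t => vsPeel.all fun vd => decide (t.2.getD vd.1 0 ≤ vd.2)

/-- The degree guard, unfolded. [this work] -/
theorem deg_of_degOKPeel {L : List (ℤ × List ℕ)} (h : degOKPeel L = true) :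
    ∀ t ∈ L, ∀ vd ∈ vsPeel, t.2.getD vd.1 0 ≤ vd.2 := by
  intro t ht vd hvd
  rw [degOKPeel, List.all_eq_true] at h
  have h2 := h t ht
  rw [List.all_eq_true] at h2
  exact of_decide_eq_true (h2 vd hvd)

/-- Soundness of a passed check on `vsPeel`. [this work] -/
theorem evalKL_nonneg_of_checkPeel {L : List (ℤ × List ℕ)} (h : (degOKPeel L && boxcheckK vsPeel L) = true)
    (x : Fin 7 → ℝ) (hx : ∀ i, 0 ≤ x i ∧ x i ≤ 1) : 0 ≤ evalKL 7 L x := by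
  rw [Bool.and_eq_true] at h
  exact evalKL_nonneg_of_boxcheckK vsPeel L h.2 (by decide) (deg_of_degOKPeel h.1) x hx

/-- **Certificate**: `boxcheckK` accepts `Δ_W` for the seven deficient patterns, and `z_O`. [this work] -/
theorem peel_cert :
    ((allPatts.filter fun W => W ≠ Finset.univ).all fun W => degOKPeel (peelDeltaK W) && boxcheckK vsPeel (peelDeltaK W)) = true
    ∧ (degOKPeel (zWK Finset.univ) && boxcheckK vsPeel (zWK Finset.univ)) = true := by
  constructor <;> native_decide

/-- **`Δ_W ≥ 0` on `[0,1]^7`** for every deficient pattern `W` (COND_TOP at order 4). [this work] -/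
theorem peelDelta_nonneg (W : Finset (Fin 3)) (hW : W ≠ Finset.univ) (x : Fin 7 → ℝ) (hx : ∀ i, 0 ≤ x i ∧ x i ≤ 1) :
    0 ≤ evalKL 7 (peelDeltaK W) x := by
  have h := peel_cert.1
  rw [List.all_eq_true] at h
  have hW' : W ∈ allPatts.filter fun W => W ≠ Finset.univ := List.mem_filter.2 ⟨mem_allPatts W, by simpa using hW⟩
  exact evalKL_nonneg_of_checkPeel (h W hW') x hx

/-- **`z_O ≥ 0` on `[0,1]^7`** (the density on the full pattern). [this work] -/
theorem zO_four_nonneg (x : Fin 7 → ℝ) (hx : ∀ i, 0 ≤ x i ∧ x i ≤ 1) : 0 ≤ evalKL 7 (zWK Finset.univ) x :=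
  evalKL_nonneg_of_checkPeel peel_cert.2 x hx

/-- The pattern inequality in product form: `z_O·z'_W ≤ z'_O·(x₆ z_W + (1−x₆) z_O)` (also for `W = univ`, trivially). [this work] -/
theorem peel_pattern_ineq_four (W : Finset (Fin 3)) (x : Fin 7 → ℝ) (hx : ∀ i, 0 ≤ x i ∧ x i ≤ 1) :
    evalKL 7 (zWK Finset.univ) x * evalKL 7 (zWK W) (Function.update x 6 1) ≤
      evalKL 7 (zWK Finset.univ) (Function.update x 6 1) *
        (x 6 * evalKL 7 (zWK W) x + (1 - x 6) * evalKL 7 (zWK Finset.univ) x) := by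
  by_cases hW : W = Finset.univ
  · subst hW; nlinarith
  · have h := peelDelta_nonneg W hW x hx
    rw [evalKL_peelDeltaK] at h
    linarith

/-! ## The cell-level peeling inequality at order 4 -/

/-- The top region is region `6 = {0,1,2}`; adding it makes the pattern everything. [this work] -/
theorem patt_insert_six (R : Finset (Fin 7)) : patt (insert 6 R) = Finset.univ := by
  rw [patt, Finset.biUnion_insert]
  apply Finset.eq_univ_of_forall
  intro j
  apply Finset.mem_union_left
  fin_cases j <;> decide

/-- Cell mass with the top region closed / open versus the top-deleted cell mass. [this work] -/
theorem cellProb_split_six (x : Fin 7 → ℝ) (R : Finset (Fin 7)) (hR : (6 : Fin 7) ∉ R) :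
    cellProb x R = x 6 * cellProb (Function.update x 6 1) R ∧
      cellProb x (insert 6 R) = (1 - x 6) * cellProb (Function.update x 6 1) R := by
  have key : ∀ y : Fin 7 → ℝ, ∀ S : Finset (Fin 7),
      cellProb y S = (if (6 : Fin 7) ∈ S then 1 - y 6 else y 6) *
        ∏ i ∈ Finset.univ.erase 6, (if i ∈ S then 1 - y i else y i) := by
    intro y S
    rw [cellProb, ← Finset.mul_prod_erase _ _ (Finset.mem_univ (6 : Fin 7))]
  have hrest : ∀ S : Finset (Fin 7), (∀ i, i ≠ 6 → (i ∈ S ↔ i ∈ R)) →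
      ∏ i ∈ Finset.univ.erase 6, (if i ∈ S then 1 - x i else x i)
        = ∏ i ∈ Finset.univ.erase 6, (if i ∈ R then 1 - Function.update x 6 1 i else Function.update x 6 1 i) := by
    intro S hS
    refine Finset.prod_congr rfl fun i hi => ?_
    have hi6 : i ≠ 6 := Finset.ne_of_mem_erase hi
    by_cases hiR : i ∈ R
    · rw [if_pos ((hS i hi6).2 hiR), if_pos hiR, Function.update_of_ne hi6]
    · rw [if_neg (fun h => hiR ((hS i hi6).1 h)), if_neg hiR, Function.update_of_ne hi6]
  have h1 := key (Function.update x 6 1) R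
  rw [if_neg hR, Function.update_self] at h1
  constructor
  · rw [key x R, if_neg hR, hrest R (fun i _ => Iff.rfl), h1, one_mul]
  · rw [key x (insert 6 R), if_pos (Finset.mem_insert_self 6 R),
      hrest (insert 6 R) (fun i hi6 => by simp [Finset.mem_insert, hi6]), h1, one_mul]

/-- Cells containing the top region have mass `0` once the top region is deleted. [this work] -/
theorem cellProb_update_six_of_mem (x : Fin 7 → ℝ) (R : Finset (Fin 7)) (hR : (6 : Fin 7) ∈ R) :
    cellProb (Function.update x 6 1) R = 0 := by
  rw [cellProb]
  exact Finset.prod_eq_zero (Finset.mem_univ (6 : Fin 7)) (by rw [if_pos hR, Function.update_self, sub_self])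

/-- **TOP-REGION PEELING at order 4 (cell form).**  For `x ∈ [0,1]^7`, `x' = x[6 ↦ 1]` (top region deleted) and every family `U` of nodes
that is closed under adding the top region (in particular every up-closed family):
`z_O(x') · Σ_{R∈U} z_{patt R}(x)·cellProb x R ≥ z_O(x) · Σ_{R∈U} z_{patt R}(x')·cellProb x' R`. [this work] -/
theorem peel_sum_ineq_four (x : Fin 7 → ℝ) (hx : ∀ i, 0 ≤ x i ∧ x i ≤ 1) (U : Finset (Finset (Fin 7)))
    (hU : ∀ R ∈ U, insert 6 R ∈ U) :
    evalKL 7 (zWK Finset.univ) x *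
        ∑ R ∈ U, evalKL 7 (zWK (patt R)) (Function.update x 6 1) * cellProb (Function.update x 6 1) R ≤
      evalKL 7 (zWK Finset.univ) (Function.update x 6 1) *
        ∑ R ∈ U, evalKL 7 (zWK (patt R)) x * cellProb x R := by
  classical
  set x' := Function.update x 6 1 with hx'
  -- encode nodes as (node without 6, 6 ∈ node)
  set enc : Finset (Fin 7) → Finset (Fin 7) × Bool := fun R => (R.erase 6, decide ((6 : Fin 7) ∈ R)) with henc
  have enc_inj : Function.Injective enc := by
    intro R S h
    simp only [henc, Prod.mk.injEq, decide_eq_decide] at h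
    obtain ⟨h1, h2⟩ := h
    ext i
    by_cases hi : i = 6
    · subst hi; exact h2
    · have := congrArg (fun T => i ∈ T) h1
      simpa [Finset.mem_erase, hi] using this
  set U' := U.image enc with hU'
  -- weights of the abstract lemma
  set P' : Finset (Fin 7) → ℝ := fun R => cellProb x' R
  set z : Finset (Fin 7) → ℝ := fun R => evalKL 7 (zWK (patt R)) x
  set z' : Finset (Fin 7) → ℝ := fun R => evalKL 7 (zWK (patt R)) x'
  set zO := evalKL 7 (zWK Finset.univ) x
  set zO' := evalKL 7 (zWK Finset.univ) x'
  have hlam1 : x 6 ≤ 1 := (hx 6).2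
  have hP : ∀ R, 0 ≤ P' R := fun R => cellProb_nonneg (fun i => by
    by_cases hi : i = 6
    · subst hi; simp [hx']
    · rw [hx', Function.update_of_ne hi]; exact hx i) R
  have hx'box : ∀ i, 0 ≤ x' i ∧ x' i ≤ 1 := fun i => by
    by_cases hi : i = 6
    · subst hi; simp [hx']
    · rw [hx', Function.update_of_ne hi]; exact hx i
  have hzO : 0 ≤ zO := zO_four_nonneg x hx
  have hzO' : 0 ≤ zO' := zO_four_nonneg x' hx'box
  have hΔ : ∀ R, zO * z' R ≤ zO' * (x 6 * z R + (1 - x 6) * zO) := fun R => peel_pattern_ineq_four (patt R) x hx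
  have hUc : ∀ R, (R, false) ∈ U' → (R, true) ∈ U' := by
    intro R hR
    rw [hU', Finset.mem_image] at hR ⊢
    obtain ⟨S, hS, hSR⟩ := hR
    simp only [henc, Prod.mk.injEq, decide_eq_false_iff_not] at hSR
    obtain ⟨hS1, hS6⟩ := hSR
    refine ⟨insert 6 S, hU S hS, ?_⟩
    simp only [henc, Prod.mk.injEq, Finset.mem_insert_self, decide_true, and_true]
    rw [Finset.erase_insert hS6, ← hS1, Finset.erase_eq_of_notMem hS6]
  have main := peel_collapse P' z z' zO zO' (x 6) U' hUc hzO hzO' hP hlam1 hΔ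
  -- identify the two sums
  have hsumR : ∑ c ∈ U', (if c.2 then (1 - x 6) * P' c.1 * zO else x 6 * P' c.1 * z c.1)
      = ∑ R ∈ U, evalKL 7 (zWK (patt R)) x * cellProb x R := by
    rw [hU', Finset.sum_image (fun R _ S _ h => enc_inj h)]
    refine Finset.sum_congr rfl fun R _ => ?_
    by_cases h6 : (6 : Fin 7) ∈ R
    · have hsplit := (cellProb_split_six x (R.erase 6) (Finset.notMem_erase 6 R)).2
      rw [Finset.insert_erase h6] at hsplit
      have hpatt : patt R = Finset.univ := by rw [← Finset.insert_erase h6]; exact patt_insert_six _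
      simp only [henc, h6, decide_true, if_true, hpatt]
      change (1 - x 6) * cellProb x' (R.erase 6) * zO = zO * cellProb x R
      rw [hsplit]; ring
    · have hsplit := (cellProb_split_six x R h6).1
      simp only [henc, h6, decide_false, Finset.erase_eq_of_notMem h6]
      change x 6 * cellProb x' R * z R = z R * cellProb x R
      rw [hsplit]; ring
  have hsumL : ∑ R ∈ univ.filter (fun R => (R, false) ∈ U'), P' R * z' R
      = ∑ R ∈ U, evalKL 7 (zWK (patt R)) x' * cellProb x' R := by
    -- terms of U containing 6 vanish; the others are exactly the filter
    rw [← Finset.sum_filter_add_sum_filter_not U (fun R => (6 : Fin 7) ∈ R)]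
    have hzero : ∑ R ∈ U.filter (fun R => (6 : Fin 7) ∈ R), evalKL 7 (zWK (patt R)) x' * cellProb x' R = 0 :=
      Finset.sum_eq_zero fun R hR => by
        rw [cellProb_update_six_of_mem x R (Finset.mem_filter.1 hR).2, mul_zero]
    rw [hzero, zero_add]
    have hset : univ.filter (fun R => (R, false) ∈ U') = U.filter (fun R => (6 : Fin 7) ∉ R) := by
      ext R
      simp only [Finset.mem_filter, Finset.mem_univ, true_and, hU', Finset.mem_image, henc, Prod.mk.injEq,
        decide_eq_false_iff_not]
      constructor
      · rintro ⟨S, hS, hS1, hS6⟩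
        rw [Finset.erase_eq_of_notMem hS6] at hS1
        subst hS1; exact ⟨hS, hS6⟩
      · rintro ⟨hR, h6⟩
        exact ⟨R, hR, Finset.erase_eq_of_notMem h6, h6⟩
    rw [hset]
    refine Finset.sum_congr rfl fun R _ => ?_
    change cellProb x' R * evalKL 7 (zWK (patt R)) x' = _
    ring
  rw [hsumR, hsumL] at main
  exact main

end SahiFreeSlot

end Summit.CriticalPhenomena.PercolationContinuityZ3.Theorems
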